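import Literature.NumberTheory.Sieve.Maynard2016GPYWeights
import Literature.NumberTheory.Sieve.PolymathLcmSums

/-!
# Maynard (2016), Lemma 6: the cutoffs of (5.3)–(5.4) and the expansion of `I_k^{(1)}(F)`

Trunk: AntSieve / parity (Maynard 2016 large-gaps ladder; on-path glue for the named fact
`Literature.NumberTheory.Sieve.Maynard2016.Lemma6MainTerm`).

J. Maynard, *Large gaps between primes*, Ann. of Math. 183 (2016) = arXiv:1408.5110, §§5–6.  The
last step of the proof of Lemma 6 (p. 10, display (6.20) and the sentence after it) evaluates the
main term as `Σ_{j,j'} c_j c_{j'} ∏_ℓ ∫_0^∞ F'_{ℓ,j}(t) F'_{ℓ,j'}(t) dt · (∫_0^∞ G'(t)² dt)^k`, "which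
is `I_k^{(1)}(F) I_k^{(2)}(G)` upon expanding the square in `F² = (Σ_j c_j ∏_ℓ F'_{ℓ,j})²` and using
Fubini".  This file proves, for sieve data `IsSieveData k J c Fd G` (§5, (5.3)–(5.4)):
* `IsSieveData.Fd_eq_zero` / `IsSieveData.isSieveCutoff_Fd` — the joint support condition (5.4)
  forces each `F_{ℓ,j}` to vanish on `(1/10, ∞)`, so each `F_{ℓ,j}` is a sieve cutoff with
  `S(F_{ℓ,j}) ≤ 1/10` (and `G` one with `S(G) ≤ 1`, `IsSieveData.isSieveCutoff_G`) — the form in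
  which the Fourier engine (`PolymathLcmSumsFourier`, `IsSieveCutoff.fourierWeight`) consumes them;
* `IsSieveData.I1_eq_sum` — the Fubini expansion
  `I_k^{(1)}(F) = Σ_j Σ_{j'} c_j c_{j'} ∏_ℓ ∫_0^∞ F'_{ℓ,j} F'_{ℓ,j'}`.

## References

* J. Maynard, *Large gaps between primes*, Ann. of Math. (2) 183 (2016), 915–933; arXiv:1408.5110,
  §5 displays (5.3)–(5.5), §6 Lemma 6 and display (6.20). [Maynard2016LargeGaps]
-/

noncomputable section

open Filter Finset MeasureTheory Set
open scoped BigOperators Topology ContDiff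

namespace Literature.NumberTheory.Sieve

namespace Maynard2016

variable {k J : ℕ} {c : Fin J → ℝ} {Fd : Fin k → Fin J → ℝ → ℝ} {G : ℝ → ℝ}

/-! ### Each `F_{ℓ,j}` is supported on `[0, 1/10]` -/

/-- The joint support condition (5.4) forces each `F_{ℓ,j}` to vanish on `(1/10, ∞)` (test it on the
point with `u_ℓ = u` and, for `ℓ' ≠ ℓ`, a point `u_{ℓ'} ≥ 0` where `F_{ℓ',j} ≠ 0`).
[cite: Maynard2016LargeGaps, §5 display (5.4)] -/
theorem IsSieveData.Fd_eq_zero (h : IsSieveData k J c Fd G) (ℓ : Fin k) (j : Fin J) {u : ℝ}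
    (hu : 1 / 10 < u) : Fd ℓ j u = 0 := by
  by_contra hne
  classical
  choose v hv0 hvne using fun ℓ' => h.Fd_ne_zero ℓ' j
  set w : Fin k → ℝ := fun ℓ' => if ℓ' = ℓ then u else v ℓ' with hw
  have hw0 : ∀ ℓ', 0 ≤ w ℓ' := by
    intro ℓ'
    by_cases hℓ : ℓ' = ℓ
    · simp only [hw, hℓ, if_true]; linarith
    · simp only [hw, hℓ, if_false]; exact hv0 ℓ'
  have hwne : ∀ ℓ', Fd ℓ' j (w ℓ') ≠ 0 := by
    intro ℓ'
    by_cases hℓ : ℓ' = ℓ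
    · subst hℓ; simp only [hw, if_true]; exact hne
    · simp only [hw, hℓ, if_false]; exact hvne ℓ'
  have hsum := h.Fd_support j w hw0 hwne
  have hle : w ℓ ≤ ∑ ℓ', w ℓ' :=
    Finset.single_le_sum (f := w) (fun ℓ' _ => hw0 ℓ') (Finset.mem_univ ℓ)
  have hwl : w ℓ = u := by simp [hw]
  linarith

/-- Each `F_{ℓ,j}` is a smooth cutoff with `S(F_{ℓ,j}) ≤ 1/10`. [cite: Maynard2016LargeGaps, §5 displays (5.3)–(5.4)] -/
theorem IsSieveData.isSieveCutoff_Fd (h : IsSieveData k J c Fd G) (ℓ : Fin k) (j : Fin J) :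
    IsSieveCutoff (Fd ℓ j) (1 / 10) :=
  ⟨h.Fd_smooth ℓ j, by norm_num, fun _ hu => h.Fd_eq_zero ℓ j hu⟩

/-- `G` is a smooth cutoff with `S(G) ≤ 1`. [cite: Maynard2016LargeGaps, §5 display (5.3)] -/
theorem IsSieveData.isSieveCutoff_G (h : IsSieveData k J c Fd G) : IsSieveCutoff G 1 :=
  ⟨h.G_smooth, by norm_num, h.G_support⟩

/-! ### The Fubini expansion of `I_k^{(1)}(F)` -/

/-- The one-variable factors `1_{[0,∞)} F'_{ℓ,j} F'_{ℓ,j'}` are integrable (continuous, supported on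
`[0, 1/10]`). [cite: Maynard2016LargeGaps, §6 display (6.20)] -/
private theorem integrable_indicator_deriv_mul (h : IsSieveData k J c Fd G) (ℓ : Fin k) (j j' : Fin J) :
    Integrable ((Ici (0 : ℝ)).indicator fun t => deriv (Fd ℓ j) t * deriv (Fd ℓ j') t) := by
  have hcont : Continuous fun t => deriv (Fd ℓ j) t * deriv (Fd ℓ j') t :=
    ((h.Fd_smooth ℓ j).continuous_deriv (by simp)).mul ((h.Fd_smooth ℓ j').continuous_deriv (by simp))
  have heq : (Ici (0 : ℝ)).indicator (fun t => deriv (Fd ℓ j) t * deriv (Fd ℓ j') t) =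
      (Icc (0 : ℝ) (1 / 10)).indicator fun t => deriv (Fd ℓ j) t * deriv (Fd ℓ j') t := by
    funext t
    by_cases ht : t ∈ Icc (0 : ℝ) (1 / 10)
    · rw [indicator_of_mem ht, indicator_of_mem (Set.mem_Ici.2 ht.1)]
    · rw [indicator_of_notMem ht]
      by_cases h0 : 0 ≤ t
      · rw [indicator_of_mem (Set.mem_Ici.2 h0)]
        have h1 : 1 / 10 < t := by
          by_contra h1; exact ht ⟨h0, not_lt.1 h1⟩
        rw [(h.isSieveCutoff_Fd ℓ j).deriv_eq_zero h1, zero_mul]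
      · rw [indicator_of_notMem (fun h' => h0 (Set.mem_Ici.1 h'))]
  rw [heq, integrable_indicator_iff measurableSet_Icc]
  exact hcont.continuousOn.integrableOn_compact isCompact_Icc

/-- **`I_k^{(1)}(F) = Σ_j Σ_{j'} c_j c_{j'} ∏_ℓ ∫_0^∞ F'_{ℓ,j}(t) F'_{ℓ,j'}(t) dt`** ("upon expanding
the square and using Fubini", the last step of the proof of Lemma 6). [cite: Maynard2016LargeGaps, Lemma 6 (proof, display (6.20))] -/
theorem IsSieveData.I1_eq_sum (h : IsSieveData k J c Fd G) :
    I1 c Fd = ∑ j, ∑ j', c j * c j' *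
      ∏ ℓ, ∫ t in Ioi (0 : ℝ), deriv (Fd ℓ j) t * deriv (Fd ℓ j') t := by
  -- the one-variable factors
  set g : Fin J → Fin J → Fin k → ℝ → ℝ := fun j j' ℓ =>
    (Ici (0 : ℝ)).indicator fun t => deriv (Fd ℓ j) t * deriv (Fd ℓ j') t with hg
  have hgi : ∀ j j' ℓ, Integrable (g j j' ℓ) := fun j j' ℓ => integrable_indicator_deriv_mul h ℓ j j'
  -- Step 1: the set integral as an integral of the expanded, indicator-weighted integrand
  have hS : MeasurableSet (Set.univ.pi fun _ : Fin k => Ici (0 : ℝ)) :=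
    MeasurableSet.univ_pi fun _ => measurableSet_Ici
  have hpt : (Set.univ.pi fun _ : Fin k => Ici (0 : ℝ)).indicator (fun t => Fsum c Fd t ^ 2) =
      fun t => ∑ j, ∑ j', c j * c j' * ∏ ℓ, g j j' ℓ (t ℓ) := by
    funext t
    by_cases ht : t ∈ Set.univ.pi fun _ : Fin k => Ici (0 : ℝ)
    · rw [indicator_of_mem ht, Fsum, sq, Finset.sum_mul_sum]
      refine Finset.sum_congr rfl fun j _ => Finset.sum_congr rfl fun j' _ => ?_
      have hin : ∀ ℓ, g j j' ℓ (t ℓ) = deriv (Fd ℓ j) (t ℓ) * deriv (Fd ℓ j') (t ℓ) := fun ℓ => by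
        simp only [hg]
        rw [indicator_of_mem (ht ℓ (Set.mem_univ ℓ))]
      simp_rw [hin, Finset.prod_mul_distrib]
      ring
    · rw [indicator_of_notMem ht]
      simp only [Set.mem_univ_pi, not_forall] at ht
      obtain ⟨ℓ₀, hℓ₀⟩ := ht
      symm
      refine Finset.sum_eq_zero fun j _ => Finset.sum_eq_zero fun j' _ => ?_
      rw [Finset.prod_eq_zero (Finset.mem_univ ℓ₀) (by simp only [hg]; rw [indicator_of_notMem hℓ₀]),
        mul_zero]
  rw [I1, ← integral_indicator hS, hpt]
  -- Step 2: interchange the finite sums and the integral; Fubini on each product term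
  have hterm : ∀ j j', Integrable fun t : Fin k → ℝ => c j * c j' * ∏ ℓ, g j j' ℓ (t ℓ) :=
    fun j j' => (Integrable.fintype_prod (f := g j j') (hgi j j')).const_mul _
  rw [integral_finsetSum _ fun j _ => integrable_finsetSum _ fun j' _ => hterm j j']
  refine Finset.sum_congr rfl fun j _ => ?_
  rw [integral_finsetSum _ fun j' _ => hterm j j']
  refine Finset.sum_congr rfl fun j' _ => ?_
  rw [integral_const_mul, integral_fintype_prod_volume_eq_prod]
  congr 1
  refine Finset.prod_congr rfl fun ℓ _ => ?_
  simp only [hg]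
  rw [integral_indicator measurableSet_Ici, integral_Ici_eq_integral_Ioi]

/-- `I_k^{(2)}(G) = (∫_0^∞ G'(t)² dt)^k = ∏_{ℓ < k} ∫_0^∞ G'(t) G'(t) dt` (the matching form of the
second factor). [cite: Maynard2016LargeGaps, Lemma 6 (proof, display (6.20))] -/
theorem I2_eq_prod (k : ℕ) (G : ℝ → ℝ) :
    I2 k G = ∏ _ℓ : Fin k, ∫ t in Ioi (0 : ℝ), deriv G t * deriv G t := by
  rw [I2, Finset.prod_const, Finset.card_univ, Fintype.card_fin]
  congr 1
  refine integral_congr_ae (Eventually.of_forall fun t => ?_)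
  beta_reduce
  rw [sq]

end Maynard2016

end Literature.NumberTheory.Sieve
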